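import Summits.CriticalPhenomena.PercolationContinuityZ3.Theorems.Transplant.SkelFrmFrom1Closure
import HarnessLib

/-!
# U_s execution (RULING D-Us, lead g21 V147b; WAVE-Us-MANIFEST v1.0 §3, the GEN twin of the CLOSURE BASE): **the pointwise same-`p` drop AT ONE BASE TYPE of a MULTI-TYPE
# `PlanarSkeletonFrmFrom`** — `PlanarSkeletonFrmFrom.drop_of_stepI_frQ_at` = «SkelFrmFrom1Closure»'s `samePDropOfSkeletonFrmFrom₁_of_stepI_frQ` with the one-type hypothesis
# replaced by `t ∈ Φ.types` and the seed floor raised to `max m₀ D` (the `D` of the proxies the COLUMNS will use to discharge the obligation; the base itself needs no proxy);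
# plus `indexNQ_mono_types` (the base type's sub-family)

builds on p205010 (kernel theorem, internal audit signed; external expert review pending) — nothing in this file uses p205010; CONDITIONAL assembly (hypothesis `hB` = the columns'
obligation at the base type, exactly the body of the U closure base's `h` for THIS skeleton); NOTHING about the OPEN nodes U / U_s is claimed; no statement, no `@[conjecture]`, def-free.
Lane `prim-bschramm`, seat `prim-bschramm-p3` gen 26 (design owner); helper file (`--supports stmt-CriticalPhenomena-4575 --as helper`); NON-VERBATIM new text (GEN hunk class 'h1 ↦ proxy
package' of WAVE-Us-MANIFEST §2: (i) binder swap `h1 ↦ ht : t ∈ Φ.types`, (iii) seed floor `max m₀ D`, (v) the `rw [h1]` bookkeeping becomes `indexNQ_mono_types`; the proxies themselves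
(`HasProxies.inputsAt`, Us-0 p447074) are what the GEN COLUMN rows use to discharge `hB` — the base needs none, so it is stated WITHOUT them: the multi-type drop at `t` follows from the
base type's obligation alone).
WHY IT IS THE U_s BASE: for a one-type scaled skeleton `Φs` with `L ≤ N`, apply it to `Φ := Φs.coarseFrmFrom h1 hLN` (part 5 p446718; same graph `G`, same base vertex `t`, `HasProxies` by
`hasProxies_coarseFrmFrom`, Φ2 by `coarseFrmFrom_cylSubcritical`) — the conclusion `∃ q < p, 0 < θ_t(q)` is literally the drop `SamePDropOfSkeletonFrmScaled₁` asks for (node assembly =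
Us-4, lead-gated; not in this file).
[cite: KozmaNitzan2024, §1 p. 2 (approach 1); §4 Theorem 6 (pp. 25–31), p. 17 (Step I), pp. 19–21] [cite: MartineauTassion2017, §3.3 Lemma 3.7] [cite: BenjaminiSchramm1996, Conj. 4] [this work]
-/

noncomputable section

open MeasureTheory ProbabilityTheory
open scoped ENNReal Classical

namespace Summit.CriticalPhenomena.PercolationContinuityZ3.Theorems.Transplant

open Literature.Probability.Percolation Literature.Probability.LatticeModels SimpleGraph KNLevels
open Literature.Barriers.CriticalPhenomena (HasExponentialGrowth)

/-! ## §1 The base type's sub-family of the quadrant index set -/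

namespace Skelφ.StepI

variable {V : Type}

/-- **The quadrant index set is monotone in the set of base vertices**: the family indexed by `{t}` is a sub-family of the family indexed by `types ∋ t`. [folklore] -/
theorem indexNQ_mono_types {types types' : Finset V} (h : types ⊆ types') (Sz : Finset ℕ) (SMn : Finset (ℕ × ℕ)) (sg : V → ℕ → ℕ → Fin 2 → ℤˣ) :
    indexNQ types Sz SMn sg ⊆ indexNQ types' Sz SMn sg := by
  intro i hi
  obtain ⟨ht, hog⟩ := of_mem_indexNQ hi
  obtain ⟨t, M, og⟩ := i
  simp only at ht hog
  rcases hog with ⟨hM, rfl⟩ | ⟨q, hq, rfl, fam, τ, rfl⟩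
  · exact mem_indexNQ_none (h ht) hM
  · exact mem_indexNQ_some (h ht) (by exact hq) fam τ

end Skelφ.StepI

/-! ## §2 The closure base with proxies -/

namespace PlanarSkeletonFrmFrom

variable {V : Type} {G : SimpleGraph V} [G.LocallyFinite]

/-- **THE CLOSURE BASE AT ONE BASE TYPE (multi-type carrier).**  Let `Φ : PlanarSkeletonFrmFrom G`, `t ∈ Φ.types` a base vertex, `D` a seed-floor shift (the proxies' radius in
U_s), `0 < p < 1` with a.s. uniqueness, Φ2 (`hC`) and `θ_t(p) > 0`.  Suppose the instance (`hB`) names `0 < δI < 1` and `m₀`; receives the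
Step-I‴ output — records `D₀`, `DT`, quadrants `qd`, `qdT`, orientation `ori` — with its facts (`max m₀ D ≤ k`, `1 ≤ k ≤ M₀`, `R = ψ`, `Λ = fatSeq`, shared fields, geometric clause +
shear bound at `t`); returns admissible `Sz`, `SMn`; and proves `θ_t(q) > 0` at every `q ∈ [p/2, p]` where the ORIENTED family over `indexNQ {t} Sz SMn (sgQ qd qdT ori)` holds with
accuracy `δI` and Φ2 holds.  Then some `q < p` has `θ_t(q) > 0`.  (The U closure base is the case `types = {t}`, `D = 0`.)
[cite: KozmaNitzan2024, §1 p. 2 (approach 1); §4 Theorem 6 (pp. 25–31), p. 17] [cite: MartineauTassion2017, §3.3 Lemma 3.7] -/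
theorem drop_of_stepI_frQ_at [DecidableEq V] [Countable V] (Φ : PlanarSkeletonFrmFrom G) {t : V} (ht : t ∈ Φ.types) (D : ℕ)
    (p : unitInterval) (hp0 : 0 < (p : ℝ)) (hp1 : (p : ℝ) < 1) (hU : ∀ᵐ ω ∂bondPercolation G p, numInfiniteClusters ω ≤ 1) (hC : Φ.CylSubcritical p)
    (hθ : 0 < theta G t p)
    (hB : ∃ (δI : ℝ) (m₀ : ℕ), 0 < δI ∧ δI < 1 ∧
      ∀ (D₀ DT : Skelφ.StepI.DataN V) (qd qdT : V → ℕ → ℕ → ℤˣ × ℤˣ) (ori : V → ℕ → ℕ → Bool),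
        max m₀ D ≤ D₀.k → 1 ≤ D₀.k → D₀.k ≤ D₀.M₀ → D₀.R = Skelφ.fatRadius Φ.frame hC → D₀.Λ = Skelφ.fatSeq Φ.frame hC →
        DT.Λ = D₀.Λ → DT.k = D₀.k → DT.R = D₀.R → DT.M₀ = D₀.M₀ → DT.n₁ = D₀.n₁ →
        (∀ M, D₀.M₀ ≤ M → ∀ n, D₀.n₁ M ≤ n →
          (ori t M n = true → D₀.EqGeom G Φ.φ t M n ∧ (D₀.hgt t M n).natAbs ≤ 10 * n) ∧
          (ori t M n = false → DT.EqGeom G (Skelφ.trφ Φ.φ) t M n ∧ (DT.hgt t M n).natAbs ≤ 10 * n)) →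
        ∃ (Sz : Finset ℕ) (SMn : Finset (ℕ × ℕ)), (∀ M ∈ Sz, D₀.M₀ ≤ M) ∧ (∀ q ∈ SMn, D₀.M₀ ≤ q.1 ∧ D₀.n₁ q.1 ≤ q.2) ∧
          ∀ q : unitInterval, (p : ℝ) / 2 ≤ q → (q : ℝ) ≤ p →
            (∀ i ∈ Skelφ.StepI.indexNQ {t} Sz SMn (Skelφ.StepI.sgQ qd qdT ori),
              1 - δI < (bondPercolation G q).real (Skelφ.StepI.eventO G Φ.φ D₀ DT ori i)) →
            Φ.CylSubcritical q → 0 < theta G t q) :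
    ∃ q : unitInterval, (q : ℝ) < p ∧ 0 < theta G t q := by
  obtain ⟨δI, m₀, hδI, hδI1, hB⟩ := hB
  have hC' : Skelφ.CylSubcritical G Φ.φ Φ.types p := hC
  -- Step I‴ under (κ′), multi-type, seed floor `max m₀ D`
  obtain ⟨D₀, DT, qd, qdT, ori, hk₀, hk₁, hkM, hR, hΛ, e1, e2, e3, e4, e5, hgeom, hfam⟩ :=
    Skelφ.StepI.exists_stepI_frQ_indexP_from (types := Φ.types) (Φ.graph_connected t).preconnected Φ.lip Φ.step Φ.frame
      Φ.cyl_connected hC' hp0 hp1 hU hθ hδI hδI1 (max m₀ D)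
  obtain ⟨Sz, SMn, hSz, hSMn, hq⟩ := hB D₀ DT qd qdT ori hk₀ hk₁ hkM hR hΛ e1 e2 e3 e4 e5 (fun M hM n hn => hgeom t ht M hM n hn)
  -- the base type's sub-family of the oriented Step-I‴ family over all types
  have hfam' : ∀ i ∈ Skelφ.StepI.indexNQ {t} Sz SMn (Skelφ.StepI.sgQ qd qdT ori), 1 - δI < (bondPercolation G p).real (Skelφ.StepI.eventO G Φ.φ D₀ DT ori i) :=
    fun i hi => hfam Sz SMn hSz hSMn i (Skelφ.StepI.indexNQ_mono_types (Finset.singleton_subset_iff.2 ht) Sz SMn _ hi)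
  exact Skelφ.exists_drop_of_inputs_theta' (φ := Φ.φ) (types := Φ.types) t hp0 hC'
    (Skelφ.StepI.indexNQ {t} Sz SMn (Skelφ.StepI.sgQ qd qdT ori)) (Skelφ.StepI.eventO G Φ.φ D₀ DT ori) (Skelφ.StepI.edgesO G Φ.φ D₀ DT ori)
    (fun _ => 1 - δI) (fun i _ => Skelφ.StepI.determinedBy_eventO G Φ.φ D₀ DT ori i) hfam'
    fun q hq1 hq2 hcq hCq => hq q hq1 hq2 hcq hCq

end PlanarSkeletonFrmFrom

end Summit.CriticalPhenomena.PercolationContinuityZ3.Theorems.Transplant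

end
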